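import Mathlib
import HarnessLib
import Summits.NavierStokesRegularity.NavierStokesRegularity.Theorems.UnthreadedRigidityDoorUnthreadedRigidityTwoShellPowerLaw

/-!
# Route `UnthreadedRigidityDoor`, item `UnthreadedRigidity` (W2, stmt-NavierStokesRegularity-27585) — LINE g12-1 «CO-ZONAL» / g12-2 «PERSISTENCE»:
# NO POSITIVE ADMISSIBLE PROFILE WITH NEGATIVE VORTICITY AMPLITUDE UNDER THE POWER LAW (sublinear Lane–Emden lower-bound bootstrap)

Prover file (engine-1 g74; `--supports stmt-NavierStokesRegularity-27585 --as helper`; route-independent imports).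

The last input named in `…TwoShellPowerLawSign` (the decay of a profile with `b_L ≡ 0`, `K·H ≤ 0`) is NOT needed: the branch is empty outright.
With `L = m + 2`, `K = K_L[H] = H″ + 2(L+1)H′/r = r^{−(2L+2)}(r^{2L+2}H′)′`, power law `K^{L+1} = C·H^{L−1}`, `C ≠ 0`:
1. NO ZEROS: at a zero `r₁ > 0` of `H` (a common zero with `K`, of order `L+1 ≥ 2`, so `H′(r₁) = 0`) the first integral `E = L·H′² − (L+1)KH`
   vanishes; `E` is non-increasing and `≥ 0` on this branch, so `E ≡ 0` on `[r₁,∞)`, `H′ ≡ 0`, `K ≡ 0` there, hence everywhere: `H ≡ 0`.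
2. SIGNS: so `H` and `K` have constant opposite strict signs; replacing `(H, K)` by `(−H, −K)` (`vortAmpL_neg`, `virialAdmissible_neg`) one may
   take `H > 0 > K`.
3. ★ LOWER-BOUND BOOTSTRAP (`no_positive_profile_with_negative_vorticity`): `Ψ = r^{2L+2}H′` has `Ψ′ = r^{2L+2}K < 0` and `Ψ(0⁺) = 0`, so `H′ < 0`;
   the mean value theorem on `[r/2, r]` and `|K|^{L+1} = |C|·H^{L−1} ≥ |C|·H(r)^{L−1}` on `[r/2, r]` (monotonicity) give
   `(−H′(r))^{L+1} ≥ c₀·r^{L+1}·H(r)^{L−1}`, i.e. `−H′ ≥ c₁ r H^{(L−1)/(L+1)}`; then `Φ = H^{2/(L+1)}` has `Φ′ ≤ −(2c₁/(L+1))·r`, so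
   `Φ(r) + (c₁/(L+1)) r²` is non-increasing — impossible for a POSITIVE `Φ` as `r → ∞` (a positive decreasing solution of the sublinear
   Lane–Emden equation `H″ + (2L+2)H′/r = −κH^p`, `p = (L−1)/(L+1) < 1`, does not exist).
Results (this file = steps 2–3 as tools; steps 1 and the assembly are in `…TwoShellPowerLawNonexistence`): `vortAmpL_neg`, `virialAdmissible_neg`,
★ `no_positive_profile_with_negative_vorticity`, `pos_or_neg_of_ne_zero`.

HONEST LABEL: elementary ODE lemmas (support of a rung line); nothing here bears on `UnthreadedRigidity` (27585), the door Target, W2 or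
Navier–Stokes regularity; no summit statement is proved.  MODEL/rung work; 0 kit.  [folklore]
-/

noncomputable section

-- the summit and its single sub-problem share the name (CONVENTIONS §1), as in every Theorems file
set_option linter.dupNamespace false

namespace Summit.NavierStokesRegularity.NavierStokesRegularity.Theorems.UnthreadedRigidity.MixedPair

open Set Function Filter Topology
open Summit.NavierStokesRegularity.NavierStokesRegularity.Theorems.UnthreadedRigidity.VirialHorn (VirialAdmissible vortAmpL strainAmpL)
open Summit.NavierStokesRegularity.NavierStokesRegularity.Theorems.UnthreadedRigidity.ThreadingJets (analyticOnNhd_vortAmpL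
  virialAdmissible_hasDerivAt_of_pos eq_zero_of_vortAmpL_eq_zero)

/-! ## §1 Negation symmetry -/

/-- `K_L[−H] = −K_L[H]`. -/
theorem vortAmpL_neg (L : ℕ) (H : ℝ → ℝ) (r : ℝ) : vortAmpL L (-H) r = -vortAmpL L H r := by
  simp only [vortAmpL, deriv.neg']
  have : deriv (fun x => -deriv H x) r = -deriv (deriv H) r := by
    rw [show (fun x => -deriv H x) = -deriv H from rfl, deriv.neg]
  rw [this]; ring

/-- `−H` is admissible with `H`. -/
theorem virialAdmissible_neg {L : ℕ} {H : ℝ → ℝ} (hH : VirialAdmissible L H) : VirialAdmissible L (-H) := by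
  obtain ⟨⟨h, hh, hHh⟩, C, hC⟩ := hH
  refine ⟨⟨-h, hh.neg, fun r hr => by simp [hHh r hr]⟩, C, fun r hr => ?_⟩
  obtain ⟨h0, h1, h2⟩ := hC r hr
  have e1 : deriv (-H) = fun x => -deriv H x := deriv.neg'
  have e2 : deriv (deriv (-H)) r = -deriv (deriv H) r := by
    rw [e1, show (fun x => -deriv H x) = -deriv H from rfl, deriv.neg]
  refine ⟨by simpa using h0, by rw [e1, abs_neg]; exact h1, by rw [e2, abs_neg]; exact h2⟩

/-! ## §2 ★ No positive admissible profile with negative vorticity amplitude and the power law -/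

/-- ★ **LOWER-BOUND BOOTSTRAP**: there is no `H`, analytic on `(0,∞)` with `H′(s) = 2s·h′(s²)` bounded near `0⁺` (admissibility), `H > 0`,
`K = H″ + 2(m+3)H′/r < 0` and `|K|^{m+3} = c·H^{m+1}` (`c > 0`) on `(0,∞)` (module docstring, step 3). [folklore] -/
theorem no_positive_profile_with_negative_vorticity (m : ℕ) {H : ℝ → ℝ} (hH : VirialAdmissible (m + 2) H)
    (hHa : AnalyticOnNhd ℝ H (Set.Ioi 0)) (hpos : ∀ r : ℝ, 0 < r → 0 < H r) (hKneg : ∀ r : ℝ, 0 < r → vortAmpL (m + 2) H r < 0)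
    {c : ℝ} (hc : 0 < c) (hlaw : ∀ r : ℝ, 0 < r → |vortAmpL (m + 2) H r| ^ (m + 3) = c * H r ^ (m + 1)) : False := by
  set K : ℝ → ℝ := vortAmpL (m + 2) H with hKdef
  have hK : AnalyticOnNhd ℝ K (Ioi 0) := analyticOnNhd_vortAmpL hHa
  have hHd : ∀ r, 0 < r → HasDerivAt H (deriv H r) r := fun r hr => (hHa r hr).differentiableAt.hasDerivAt
  have hH1 : ∀ r, 0 < r → HasDerivAt (deriv H) (deriv (deriv H) r) r := fun r hr => ((hHa.deriv) r hr).differentiableAt.hasDerivAt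
  -- `Ψ = r^{2m+6} H′`, `Ψ′ = r^{2m+6} K < 0`
  set Ψ : ℝ → ℝ := fun s => s ^ (2 * m + 6) * deriv H s with hΨ
  have hΨd : ∀ r, 0 < r → HasDerivAt Ψ (r ^ (2 * m + 6) * K r) r := by
    intro r hr
    have hp : HasDerivAt (fun s : ℝ => s ^ (2 * m + 6)) (((2 * m + 6 : ℕ) : ℝ) * r ^ (2 * m + 6 - 1)) r := by
      simpa using hasDerivAt_pow (2 * m + 6) r
    have h := hp.mul (hH1 r hr)
    refine h.congr_deriv ?_
    have hK2 : deriv (deriv H) r = K r - 2 * ((m : ℝ) + 3) / r * deriv H r := by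
      simp only [hKdef, vortAmpL]; push_cast; ring
    rw [hK2, show 2 * m + 6 - 1 = 2 * m + 5 by omega, show 2 * m + 6 = (2 * m + 5) + 1 by omega, pow_succ]
    push_cast
    field_simp
    ring
  have hΨanti : StrictAntiOn Ψ (Ioi 0) := by
    apply strictAntiOn_of_deriv_neg (convex_Ioi 0)
    · exact fun r hr => (hΨd r hr).continuousAt.continuousWithinAt
    · rw [interior_Ioi]; intro r hr
      have hr' : 0 < r := hr
      rw [(hΨd r hr').deriv]
      exact mul_neg_of_pos_of_neg (by positivity) (hKneg r hr')
  -- `Ψ → 0` at `0⁺`, hence `Ψ < 0` and `H′ < 0` on `(0,∞)`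
  obtain ⟨h, hh, -, hder⟩ := virialAdmissible_hasDerivAt_of_pos hH
  have hΨneg : ∀ r, 0 < r → Ψ r < 0 := by
    intro r hr
    have hcont : ContinuousOn (fun s : ℝ => 2 * s * deriv h (s ^ 2)) (Icc 0 r) := by
      have h1 : ContDiff ℝ (⊤ : ℕ∞) (deriv h) := hh.deriv'
      exact ((continuous_const.mul continuous_id).mul (h1.continuous.comp (continuous_pow 2))).continuousOn
    obtain ⟨B, hB⟩ := isCompact_Icc.exists_bound_of_continuousOn hcont
    -- `Ψ r < Ψ (r/2) ≤ |Ψ s| + … → 0`: `Ψ r ≤ 0` by letting `s → 0⁺`, then strictness from `r/2`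
    have hle : ∀ r', 0 < r' → r' ≤ r → Ψ r' ≤ 0 := by
      intro r' hr' hr'r
      have hlim : Tendsto (fun s : ℝ => B * s ^ (2 * m + 6)) (𝓝[>] 0) (𝓝 0) := by
        have hc : Continuous fun s : ℝ => B * s ^ (2 * m + 6) := continuous_const.mul (continuous_pow _)
        have h1 := hc.tendsto 0
        rw [zero_pow (by omega), mul_zero] at h1
        exact h1.mono_left nhdsWithin_le_nhds
      refine le_of_tendsto_of_tendsto tendsto_const_nhds hlim ?_
      filter_upwards [Ioo_mem_nhdsGT hr'] with s hs
      have hs0 : 0 < s := hs.1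
      have h1 : Ψ r' < Ψ s := hΨanti (mem_Ioi.2 hs0) (mem_Ioi.2 hr') hs.2
      have h2 : Ψ s ≤ B * s ^ (2 * m + 6) := by
        have h3 : |deriv H s| ≤ B := by
          have h4 := hB s ⟨hs0.le, hs.2.le.trans hr'r⟩
          rw [Real.norm_eq_abs] at h4
          rwa [(hder s hs0).deriv]
        calc Ψ s = s ^ (2 * m + 6) * deriv H s := rfl
          _ ≤ s ^ (2 * m + 6) * |deriv H s| := by gcongr; exact le_abs_self _
          _ ≤ s ^ (2 * m + 6) * B := by gcongr
          _ = B * s ^ (2 * m + 6) := by ring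
      exact h1.le.trans h2
    have h1 : Ψ r < Ψ (r / 2) := hΨanti (mem_Ioi.2 (by positivity)) (mem_Ioi.2 hr) (by linarith)
    exact lt_of_lt_of_le h1 (hle (r / 2) (by positivity) (by linarith))
  have hH'neg : ∀ r, 0 < r → deriv H r < 0 := fun r hr => by
    have h1 := hΨneg r hr
    have h2 : 0 < r ^ (2 * m + 6) := by positivity
    by_contra h3
    push Not at h3
    exact absurd (mul_nonneg h2.le h3) (not_le.mpr h1)
  have hHanti : StrictAntiOn H (Ioi 0) := by
    apply strictAntiOn_of_deriv_neg (convex_Ioi 0)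
    · exact fun r hr => (hHd r hr).continuousAt.continuousWithinAt
    · rw [interior_Ioi]; exact fun r hr => hH'neg r hr
  -- ★ `(−H′(r))^{m+3} ≥ c₀ r^{m+3} H(r)^{m+1}` (mean value on `[r/2, r]`)
  set c₀ : ℝ := c / ((2 : ℝ) ^ (2 * m + 7)) ^ (m + 3) with hc₀
  have hc₀pos : 0 < c₀ := by positivity
  have hstar : ∀ r, 0 < r → c₀ * r ^ (m + 3) * H r ^ (m + 1) ≤ (-deriv H r) ^ (m + 3) := by
    intro r hr
    have hr2 : 0 < r / 2 := by positivity
    have hcontΨ : ContinuousOn Ψ (Icc (r / 2) r) := fun s hs =>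
      (hΨd s (lt_of_lt_of_le hr2 hs.1)).continuousAt.continuousWithinAt
    have hdiffΨ : DifferentiableOn ℝ Ψ (Ioo (r / 2) r) := fun s hs =>
      (hΨd s (lt_trans hr2 hs.1)).differentiableAt.differentiableWithinAt
    obtain ⟨ξ, hξ, hξd⟩ := exists_deriv_eq_slope Ψ (by linarith : r / 2 < r) hcontΨ hdiffΨ
    have hξ0 : 0 < ξ := lt_trans hr2 hξ.1
    rw [(hΨd ξ hξ0).deriv] at hξd
    -- `Ψ r − Ψ(r/2) = ξ^{2m+6} K ξ · (r/2)`
    have hdiff : Ψ r - Ψ (r / 2) = ξ ^ (2 * m + 6) * K ξ * (r / 2) := by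
      rw [hξd]; field_simp; ring
    have hKξ : K ξ < 0 := hKneg ξ hξ0
    -- `−H′(r) ≥ r |K ξ| / 2^{2m+7}`
    have hlow : r * |K ξ| / (2 : ℝ) ^ (2 * m + 7) ≤ -deriv H r := by
      have h1 : -Ψ r ≥ (r / 2) * (r / 2) ^ (2 * m + 6) * |K ξ| := by
        have h2 : Ψ (r / 2) < 0 := hΨneg (r / 2) hr2
        have h3 : (r / 2) ^ (2 * m + 6) ≤ ξ ^ (2 * m + 6) := pow_le_pow_left₀ hr2.le hξ.1.le _
        rw [abs_of_neg hKξ]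
        have h4 : (r / 2) * (r / 2) ^ (2 * m + 6) * (-K ξ) ≤ (r / 2) * ξ ^ (2 * m + 6) * (-K ξ) := by
          gcongr; linarith
        linarith [h4, hdiff, h2]
      have h5 : -deriv H r = -Ψ r / r ^ (2 * m + 6) := by
        simp only [hΨ]; field_simp
      rw [h5, le_div_iff₀ (by positivity)]
      calc r * |K ξ| / 2 ^ (2 * m + 7) * r ^ (2 * m + 6) = (r / 2) * (r / 2) ^ (2 * m + 6) * |K ξ| := by
            rw [div_pow, pow_succ]; field_simp
        _ ≤ -Ψ r := h1
    -- `|K ξ|^{m+3} = c H(ξ)^{m+1} ≥ c H(r)^{m+1}`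
    have hHξ : H r ≤ H ξ := (hHanti (mem_Ioi.2 hξ0) (mem_Ioi.2 hr) hξ.2).le
    have h6 : c * H r ^ (m + 1) ≤ |K ξ| ^ (m + 3) := by
      rw [hlaw ξ hξ0]
      gcongr
      · exact (hpos r hr).le
    have h7 : (r * |K ξ| / (2 : ℝ) ^ (2 * m + 7)) ^ (m + 3) ≤ (-deriv H r) ^ (m + 3) :=
      pow_le_pow_left₀ (by positivity) hlow _
    calc c₀ * r ^ (m + 3) * H r ^ (m + 1) = (r / (2 : ℝ) ^ (2 * m + 7)) ^ (m + 3) * (c * H r ^ (m + 1)) := by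
          rw [hc₀, div_pow]; ring
      _ ≤ (r / (2 : ℝ) ^ (2 * m + 7)) ^ (m + 3) * |K ξ| ^ (m + 3) := by gcongr
      _ = (r * |K ξ| / (2 : ℝ) ^ (2 * m + 7)) ^ (m + 3) := by rw [← mul_pow]; ring
      _ ≤ (-deriv H r) ^ (m + 3) := h7
  -- ★ `−H′ ≥ c₁ r H^{(m+1)/(m+3)}`, `c₁ = c₀^{1/(m+3)}`
  set q : ℝ := (m : ℝ) + 3 with hq
  have hq0 : 0 < q := by positivity
  have hqn : ((m + 3 : ℕ) : ℝ) = q := by rw [hq]; push_cast; ring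
  set c₁ : ℝ := c₀ ^ (q⁻¹) with hc₁
  have hc₁pos : 0 < c₁ := Real.rpow_pos_of_pos hc₀pos _
  have hroot : ∀ r, 0 < r → c₁ * r * H r ^ (((m : ℝ) + 1) / q) ≤ -deriv H r := by
    intro r hr
    have hHr := hpos r hr
    have hx : 0 ≤ -deriv H r := by linarith [hH'neg r hr]
    -- take `q`-th roots of `hstar`
    have h1 : (c₀ * r ^ (m + 3) * H r ^ (m + 1)) ^ (q⁻¹) ≤ ((-deriv H r) ^ (m + 3)) ^ (q⁻¹) :=
      Real.rpow_le_rpow (by positivity) (hstar r hr) (by positivity)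
    have h2 : ((-deriv H r) ^ (m + 3)) ^ (q⁻¹) = -deriv H r := by
      rw [← hqn]; exact Real.pow_rpow_inv_natCast hx (by omega)
    have h3 : (c₀ * r ^ (m + 3) * H r ^ (m + 1)) ^ (q⁻¹) = c₁ * r * H r ^ (((m : ℝ) + 1) / q) := by
      rw [Real.mul_rpow (by positivity) (by positivity), Real.mul_rpow (by positivity) (by positivity), hc₁]
      congr 1
      · congr 1
        rw [← hqn]; exact Real.pow_rpow_inv_natCast hr.le (by omega)
      · rw [← Real.rpow_natCast (H r) (m + 1), ← Real.rpow_mul hHr.le]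
        congr 1
        push_cast
        rw [div_eq_mul_inv]
    rw [h2, h3] at h1
    exact h1
  -- ★ `Φ = H^{2/q}` has `Φ′ ≤ −(2/q) c₁ r`; `Φ + (c₁/q) r²` is non-increasing on `(0,∞)`
  set Φ : ℝ → ℝ := fun s => H s ^ ((2 : ℝ) / q) + c₁ / q * s ^ 2 with hΦ
  have hΦd : ∀ r, 0 < r → HasDerivAt Φ (deriv H r * ((2 : ℝ) / q) * H r ^ ((2 : ℝ) / q - 1) + c₁ / q * (2 * r)) r := by
    intro r hr
    have h1 : HasDerivAt (fun s => H s ^ ((2 : ℝ) / q)) (deriv H r * ((2 : ℝ) / q) * H r ^ ((2 : ℝ) / q - 1)) r :=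
      (hHd r hr).rpow_const (Or.inl (hpos r hr).ne')
    have h2 : HasDerivAt (fun s : ℝ => c₁ / q * s ^ 2) (c₁ / q * (2 * r)) r := by
      have := (hasDerivAt_pow 2 r).const_mul (c₁ / q)
      simpa using this
    exact h1.add h2
  have hΦanti : AntitoneOn Φ (Ioi 0) := by
    apply antitoneOn_of_deriv_nonpos (convex_Ioi 0)
    · exact fun r hr => (hΦd r hr).continuousAt.continuousWithinAt
    · rw [interior_Ioi]; exact fun r hr => (hΦd r hr).differentiableAt.differentiableWithinAt
    · rw [interior_Ioi]; intro r hr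
      have hr' : 0 < r := hr
      rw [(hΦd r hr').deriv]
      have hHr := hpos r hr'
      -- `H′·(2/q)·H^{2/q−1} ≤ −(2/q) c₁ r`
      have h1 := hroot r hr'
      have hexp : H r ^ ((2 : ℝ) / q - 1) * H r ^ (((m : ℝ) + 1) / q) = 1 := by
        rw [← Real.rpow_add hHr]
        have : (2 : ℝ) / q - 1 + ((m : ℝ) + 1) / q = 0 := by rw [hq]; field_simp; ring
        rw [this, Real.rpow_zero]
      have hpow_pos : 0 < H r ^ ((2 : ℝ) / q - 1) := Real.rpow_pos_of_pos hHr _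
      have h2 : deriv H r * H r ^ ((2 : ℝ) / q - 1) ≤ -(c₁ * r) := by
        have h3 : deriv H r * H r ^ ((2 : ℝ) / q - 1) ≤ -(c₁ * r * H r ^ (((m : ℝ) + 1) / q)) * H r ^ ((2 : ℝ) / q - 1) :=
          mul_le_mul_of_nonneg_right (by linarith) hpow_pos.le
        calc deriv H r * H r ^ ((2 : ℝ) / q - 1) ≤ -(c₁ * r * H r ^ (((m : ℝ) + 1) / q)) * H r ^ ((2 : ℝ) / q - 1) := h3
          _ = -(c₁ * r) * (H r ^ ((2 : ℝ) / q - 1) * H r ^ (((m : ℝ) + 1) / q)) := by ring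
          _ = -(c₁ * r) := by rw [hexp, mul_one]
      have h4 : deriv H r * ((2 : ℝ) / q) * H r ^ ((2 : ℝ) / q - 1) = (2 / q) * (deriv H r * H r ^ ((2 : ℝ) / q - 1)) := by ring
      rw [h4]
      have h5 : (2 : ℝ) / q * (deriv H r * H r ^ ((2 : ℝ) / q - 1)) ≤ (2 / q) * (-(c₁ * r)) :=
        mul_le_mul_of_nonneg_left h2 (by positivity)
      have h6 : c₁ / q * (2 * r) = -((2 : ℝ) / q * (-(c₁ * r))) := by ring
      linarith
  -- contradiction as `r → ∞`: `(c₁/q) r² ≤ Φ 1` for `r ≥ 1`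
  have hbound : ∀ r, 1 ≤ r → c₁ / q * r ^ 2 ≤ Φ 1 := by
    intro r hr
    have h1 : Φ r ≤ Φ 1 := hΦanti (mem_Ioi.2 one_pos) (mem_Ioi.2 (by linarith)) hr
    have h2 : 0 ≤ H r ^ ((2 : ℝ) / q) := Real.rpow_nonneg (hpos r (by linarith)).le _
    have h3 : Φ r = H r ^ ((2 : ℝ) / q) + c₁ / q * r ^ 2 := rfl
    linarith
  set R : ℝ := Φ 1 * q / c₁ + 2 with hR
  have hcq : 0 < c₁ / q := by positivity
  have hR1 : 1 ≤ R := by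
    rw [hR]
    have : 0 ≤ Φ 1 * q / c₁ := by
      have hΦ1 : 0 ≤ Φ 1 := by
        have := hbound 1 le_rfl
        nlinarith
      positivity
    linarith
  have h1 := hbound R hR1
  have h2 : c₁ / q * R ^ 2 > Φ 1 := by
    have hR' : R > Φ 1 * q / c₁ := by rw [hR]; linarith
    have hRpos : 0 < R := by linarith
    calc c₁ / q * R ^ 2 = (c₁ / q * R) * R := by ring
      _ ≥ (c₁ / q * R) * 1 := by gcongr
      _ = c₁ / q * R := by ring
      _ > c₁ / q * (Φ 1 * q / c₁) := by gcongr
      _ = Φ 1 := by field_simp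
  linarith

/-! ## §3 A sign lemma -/

/-- a continuous function without zeros on `(0,∞)` keeps a strict sign there. -/
theorem pos_or_neg_of_ne_zero {f : ℝ → ℝ} (hf : ContinuousOn f (Ioi 0)) (hne : ∀ r : ℝ, 0 < r → f r ≠ 0) :
    (∀ r : ℝ, 0 < r → 0 < f r) ∨ (∀ r : ℝ, 0 < r → f r < 0) := by
  by_contra h
  simp only [not_or, not_forall, not_lt] at h
  obtain ⟨⟨a, ha, hfa⟩, ⟨b, hb, hfb⟩⟩ := h
  have hfa' : f a < 0 := lt_of_le_of_ne hfa (hne a ha)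
  have hfb' : 0 < f b := lt_of_le_of_ne hfb (fun h => hne b hb h.symm)
  -- intermediate value on the segment between `a` and `b`
  have hpc : IsPreconnected (Set.uIcc a b) := isPreconnected_uIcc
  have hsub : Set.uIcc a b ⊆ Ioi 0 := fun x hx => by
    rcases Set.mem_uIcc.mp hx with ⟨h1, -⟩ | ⟨h1, -⟩
    · exact lt_of_lt_of_le ha h1
    · exact lt_of_lt_of_le hb h1
  obtain ⟨c, hc, hfc⟩ := hpc.intermediate_value Set.left_mem_uIcc Set.right_mem_uIcc (hf.mono hsub) ⟨hfa'.le, hfb'.le⟩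
  exact hne c (hsub hc) hfc

end Summit.NavierStokesRegularity.NavierStokesRegularity.Theorems.UnthreadedRigidity.MixedPair

end
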